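import Literature.Probability.RandomPlanarGeometry.SLERealFlowIto
import Literature.Probability.Process.ContinuousHitting
import HarnessLib

/-!
# The localised pole data of the Möbius image of chordal SLE₆ (processes on the Wiener space)

Topic `Probability/RandomPlanarGeometry`. Definitions only (real, total). Stochastic side of
G. F. Lawler, *Conformally Invariant Processes in the Plane* (2005), §6.3, Thm. 6.13 / Prop. 6.14
for the re-targeting Möbius map `Φ_x(z) = xz/(z + x) = a + b/(p - z)`, `a = x`, `b = x²`,
`p = -x` (tree: `retargetMoebius`, `retarget_eq_moebiusConj_init`; the target is the named fact
`sle_six_moebius_locality` of `SLESixMoebiusLocality.lean`).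

On the canonical space `(ℝ≥0 → ℝ, preWienerMeasure)` with driving function `W = √6 B`
(`sleDriving 6`), the pole data of the conjugation `h_t = moebiusConj a b P d₁ d₂`
(`LoewnerMoebiusConjugation.lean`, `LoewnerMoebiusClock.lean`) are functionals of the single real
process `X_t = g_t(p) - W_t`, the frozen real Loewner flow of the pole (`gap x = sleRealFlowStop 6 (-x)`):
`d₁ = exp(-∫ 2/X²)`, `E = ∫ 4 d₁/X³`, the image far point `A = a - (b/2) E = h_t(∞)`, the image
driving function `h_t(W_t) = A + b d₁/X` and the capacity clock `∫ (b d₁/X²)²`. Here they are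
**localised** at the stopping time `locTime x n` — the first exit of `X` from the band
`1/N < |X| < N`, of the ratio `b d₁/|X|` from `(1/N, N)`, capped at the time `N` (`N = n + 1`) —
after which every integrand is killed (`trunc`) and `X` is stopped, exactly as in the tree's
treatment of Lawler's one- and two-point martingales (`SLERealFlowIto`, `SLETwoPointItoProofs`):

* `gap`, `bandLo`, `bandHi`, `gapExit`, `poleDerivPre`, `ratioPre`, `locTime`;
* the localised processes `X`, `dRate`, `D` (`= d₁`), `eRate`, `E`, `farPt` (`= A`), `drv`
  (`= h_t(W_t)`, the image driving function read in the original time), `clkRate`, `clk`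
  (the capacity clock) and `diffusion` (`= √6 b d₁/X²`, the `dB`-coefficient of `drv`).

The box `{1/N < |X| < N} ∩ {1/N < b d₁/|X| < N} ∩ {t < N}` is chosen symmetric under the
dictionary between the chain and its Möbius image (`|X| ↔ b d̂₁/|X̂|`, `d₁ = d̂₁`, original time
`↔ ∫ b² d̂₁²/X̂⁴`), so that the same exit functional read on the image side is intrinsic to the
image driving function. The martingale property (`drv` is an Itô process with ZERO drift at
`κ = 6` and diffusion coefficient `diffusion`) is `SLESixMoebiusItoProcess.lean`.

## References

* G. F. Lawler, *Conformally Invariant Processes in the Plane*, AMS (2005), §4.6.1, §6.3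
  (Thm. 6.13, Prop. 6.14). [Lawler2005]
-/

noncomputable section

open MeasureTheory Set
open scoped NNReal

namespace Literature.Probability.RandomPlanarGeometry

namespace SLESixMoebius

open Literature.Probability.Process Literature.Analysis.FunctionSpaces

variable (x : ℝ) (n : ℕ)

/-! ### Levels and the band of the gap -/

/-- The level `N = n + 1` of the `n`-th localisation. [folklore] -/
def level (n : ℕ) : ℝ := (n : ℝ) + 1

/-- Lower end of the band of the gap `X = g_t(-x) - W_t` (which has the sign of `-x`):
`-N` for `x > 0`, `1/N` for `x < 0`. [folklore] -/
def bandLo : ℝ := if 0 < x then -level n else 1 / level n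

/-- Upper end of the band of the gap: `-1/N` for `x > 0`, `N` for `x < 0`. [folklore] -/
def bandHi : ℝ := if 0 < x then -(1 / level n) else level n

/-! ### The gap of the pole and the localising time -/

/-- **The gap of the pole** `X_t = g_t(-x) - √6 B_t`, the frozen real SLE₆ flow of the pole
`p = -x` of `Φ_x` (`sleRealFlowStop 6 (-x)`; frozen at `0` from the swallowing time `T_{-x}` on).
[cite: Lawler2005, §6.2 eq. (6.3)] -/
def gap : ℝ≥0 → (ℝ≥0 → ℝ) → ℝ := sleRealFlowStop 6 (-x)

/-- The first exit of the gap from the band `(bandLo, bandHi)` (`1/N < |X| < N`). [folklore] -/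
def gapExit : (ℝ≥0 → ℝ) → WithTop ℝ≥0 := Process.exitTime (gap x) (bandLo x n) (bandHi x n)

/-- The first jet `d₁ = exp(-∫₀ᵗ 2/X² ds)` computed along the gap stopped at `gapExit`
(integrand killed after `gapExit`). [cite: Lawler2005, §4.6.1] -/
def poleDerivPre : ℝ≥0 → (ℝ≥0 → ℝ) → ℝ := fun t ω ↦
  Real.exp (-timeIntegral (trunc (gapExit x n)
    fun s ω ↦ 2 / stoppedProcess (gap x) (gapExit x n) s ω ^ 2) t ω)

/-- The ratio `b d₁/|X|` (`b = x²`) along the gap stopped at `gapExit`: the size of the gap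
`ĝ_t(x) - Ŵ_t` of the tracked point `x` under the IMAGE chain. [cite: Lawler2005, §4.6.1] -/
def ratioPre : ℝ≥0 → (ℝ≥0 → ℝ) → ℝ := fun t ω ↦
  x ^ 2 * poleDerivPre x n t ω / |stoppedProcess (gap x) (gapExit x n) t ω|

/-- **The localising time** `ρ_n`: the first exit of the gap from `1/N < |X| < N`, of the ratio
`b d₁/|X|` from `(1/N, N)`, capped at time `N`. [folklore] -/
def locTime : (ℝ≥0 → ℝ) → WithTop ℝ≥0 := fun ω ↦
  min (gapExit x n ω) (min (Process.exitTime (ratioPre x n) (1 / level n) (level n) ω)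
    (((n : ℝ≥0) + 1 : ℝ≥0) : WithTop ℝ≥0))

/-! ### The localised pole data, image driver and capacity clock -/

/-- The gap stopped at the localising time. [folklore] -/
def X : ℝ≥0 → (ℝ≥0 → ℝ) → ℝ := stoppedProcess (gap x) (locTime x n)

/-- The killed rate `𝟙_{s ≤ ρ} 2/X_s²` of `-log d₁`. [cite: Lawler2005, §4.6.1] -/
def dRate : ℝ≥0 → (ℝ≥0 → ℝ) → ℝ := trunc (locTime x n) fun s ω ↦ 2 / X x n s ω ^ 2

/-- **The localised first jet** `d₁(t) = exp(-∫₀^{t∧ρ} 2/X² ds)` (`= g_t'(-x)` before `ρ`).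
[cite: Lawler2005, §4.6.1] -/
def D : ℝ≥0 → (ℝ≥0 → ℝ) → ℝ := fun t ω ↦ Real.exp (-timeIntegral (dRate x n) t ω)

/-- The killed rate `𝟙_{s ≤ ρ} 4 d₁/X³` of the jet ratio `E = d₂/d₁`. [cite: Lawler2005, §4.6.1] -/
def eRate : ℝ≥0 → (ℝ≥0 → ℝ) → ℝ := trunc (locTime x n) fun s ω ↦ 4 * D x n s ω / X x n s ω ^ 3

/-- **The localised jet ratio** `E_t = ∫₀^{t∧ρ} 4 d₁/X³ ds`. [cite: Lawler2005, §4.6.1] -/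
def E : ℝ≥0 → (ℝ≥0 → ℝ) → ℝ := timeIntegral (eRate x n)

/-- **The localised image far point** `A_t = a - (b/2) E_t = h_t(∞)` (`a = x`, `b = x²`).
[cite: Lawler2005, §4.6.1] -/
def farPt : ℝ≥0 → (ℝ≥0 → ℝ) → ℝ := fun t ω ↦ x - x ^ 2 / 2 * E x n t ω

/-- **The localised image driving function** `h_t(W_t) = A_t + b d₁(t)/X_t`, read in the
original time (Lawler §6.3: `U*_t = Φ_t(U_t)`), frozen from `ρ` on. [cite: Lawler2005, §6.3] -/
def drv : ℝ≥0 → (ℝ≥0 → ℝ) → ℝ := fun t ω ↦ farPt x n t ω + x ^ 2 * D x n t ω / X x n t ω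

/-- The killed rate `𝟙_{s ≤ ρ} (b d₁/X²)² = h_s'(W_s)²` of the capacity clock.
[cite: Lawler2005, §6.3] -/
def clkRate : ℝ≥0 → (ℝ≥0 → ℝ) → ℝ :=
  trunc (locTime x n) fun s ω ↦ (x ^ 2 * D x n s ω / X x n s ω ^ 2) ^ 2

/-- **The localised capacity clock** `∫₀^{t∧ρ} h_s'(W_s)² ds` (half the half-plane capacity of the
image hull; Lawler §6.3: "`t = ∫₀^{r(t)} Φ_s'(U_s)² ds`"). [cite: Lawler2005, §6.3] -/
def clk : ℝ≥0 → (ℝ≥0 → ℝ) → ℝ := timeIntegral (clkRate x n)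

/-- **The diffusion coefficient** `𝟙_{s ≤ ρ} √6 b d₁/X_s² = √κ h_s'(W_s)` of the image driving
function (Lawler §6.3: "`dU*_t = [κ/2 - 3] Φ_t''(U_t) dt + √κ Φ_t'(U_t) dB_t`", `κ = 6`; the sign
is that of `dX = (2/X) dt - √6 dB`). [cite: Lawler2005, §6.3] -/
def diffusion : ℝ≥0 → (ℝ≥0 → ℝ) → ℝ :=
  trunc (locTime x n) fun s ω ↦ Real.sqrt 6 * x ^ 2 * D x n s ω / X x n s ω ^ 2

end SLESixMoebius

end Literature.Probability.RandomPlanarGeometry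

end
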